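import Literature.AnabelianGeometry.EtaleTheta.TemperedFrobenioidCor38Sub
import Mathlib.CategoryTheory.Discrete.Basic
import Mathlib.CategoryTheory.Products.Basic
import Mathlib.CategoryTheory.EssentialImage
import Mathlib.CategoryTheory.Whiskering
import HarnessLib

/-!
# [EtTh] Cor 3.8 sub-DAG, row C38-L03 `Cor38Hyp.CompatibleWithPerfection` AS FROZEN (FACT-LIST F-2811): its
# universal closure over the data-only `PerfectionData` is FALSE at EVERY instance of the Cor. 3.8 data

S. Mochizuki, *The étale theta function and its Frobenioid-theoretic manifestations*, Publ. RIMS **45** (2009)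
[MochizukiEtTh2009], Cor. 3.8, proof, PDF p.81 l.3–4 (printed 307): "Moreover, `Ψ` is compatible with the operation of
passing to the perfection [cf. [Mzk17], Theorem 3.4, (iii)]" [cite: MochizukiEtTh2009, Cor 3.8 p.81]; S. Mochizuki,
*The geometry of Frobenioids I*, Kyushu J. Math. **62** (2008), Thm. 3.4 (iii) p.62 l.42 – p.63 l.2 ("`Ψ` induces a
`1`-unique functor `Ψ^pf : C₁^pf → C₂^pf` …") [cite: MochizukiFrdI2008, Thm. 3.4 (iii) p.62].

PROOF-ONLY companion (cell abc-iut, seat abc-iut-f-001, F fact-proving wave, tranche 133 of `plan/F-TRANCHES.tsv`) of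
the FROZEN statements-first sub-DAG `TemperedFrobenioidCor38Sub.lean` (abc-iut-w5-d124, p414329), row **F-2811**
`Cor38Hyp.CompatibleWithPerfection (P₁ : PerfectionData C₁.opsData) (P₂ : PerfectionData C₂.opsData)` :=
`∃ Ψpf, OneUniqueSquare Ψ P₁.toPf P₂.toPf Ψpf`.  The row quantifies over abc-iut-L1-t3's INTERFACE `PerfectionData`
(a category `Pf`, a functor `toPf : C → Pf`, an indexing `root` — no universal property) and asks BARE `1`-uniqueness
(the third conjunct of `OneUniqueSquare`: EVERY functor fitting the square is isomorphic to `Ψpf`).  Already the [FrdI]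
template of this reading, `PreFrobenioidData.Thm34iii_pf`, is kernel-REFUTED at THE perfection of a standard-type
Frobenioid (abc-iut-L1-d4 `not_thm34iii_pf`, `PerfectionSquareNotOneUnique.lean`); the faithful readings are the
structure-compatible square `CompatibleWithPerfectionR` of abc-iut-w5-d124 (PROVED at the canonical vocabulary:
`Cor38Hyp.compatibleWithPerfectionR_treeCatVocab`, `Sec3Cor38Thm34RowsTreeVocab.lean`) and the perfect-type case.

This file records the plan-rule-R5 verdict for the FROZEN row itself, for EVERY instance of the Cor. 3.8 data — no toy
needed, no hypothesis:

* **`Cor38Hyp.not_forall_compatibleWithPerfection`** — for every `h : Cor38Hyp C₁ C₂` (any vocabularies), NOT every pair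
  of perfection data is compatible: at the junk data `P_i♭ := (C_i × {0, 1}, A ↦ (A, 0), (A, n) ↦ (A, [n ≠ 1]))` (product
  with the discrete two-point category; operations pulled back along the first projection) no functor `B` whatsoever
  makes the square `1`-unique — if `B` is an equivalence fitting the square, so does `B` followed by the collapse
  `(X, i) ↦ (X, 0)`, which misses `(X, 1)` and is therefore not isomorphic to `B`;
* `Cor38Hyp.not_forall_forall_compatibleWithPerfection` — hence the universal closure of row F-2811 is FALSE as soon as
  the Cor. 3.8 data are inhabited (they are: e.g. abc-iut-w5-d124's `Sec3Cor38CriterionToy`, abc-iut-L2's toy tempered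
  Frobenioids), stated as an implication from any instance.

HONEST FRAMING: this refutes a typed READING (data-only `PerfectionData` + bare `1`-uniqueness), not the printed
sentence, whose faithful structure-compatible form is proved elsewhere in the tree; refereed pre-IUT material; no
definition (the junk data are structure literals inside the proof); nothing here bears on [IUTchIII] Cor. 3.12.
-/

namespace Literature.AnabelianGeometry.EtaleTheta

open CategoryTheory Opposite Literature.AlgebraicGeometry.Frobenioids

universe u₀ v₀ u v w

namespace Cor38Hyp

variable {D₀ : Type u₀} [Category.{v₀} D₀] {D₀' : Type u₀} [Category.{v₀} D₀'] {V : FrdIMonoidStub.{w}}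
  {T : RealifiedDivisorMonoids (D₀ := D₀) V} {T' : RealifiedDivisorMonoids (D₀ := D₀') V}
  {D : Type u} [Category.{v} D] {D' : Type u} [Category.{v} D']
  {VD : FrdICatStub.{u, v, w} D} {VD' : FrdICatStub.{u, v, w} D'}
  {C₁ : TemperedFrobenioid T D VD} {C₂ : TemperedFrobenioid T' D' VD'}

/-- **Row F-2811 AS FROZEN is refutable at EVERY instance of the Cor. 3.8 data**: for every `h : Cor38Hyp C₁ C₂` there
are perfection data `P₁`, `P₂` (the junk "`C_i × {0,1}`" data) with `¬ h.CompatibleWithPerfection P₁ P₂` — the bare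
`1`-uniqueness clause of `OneUniqueSquare` fails for every candidate `Ψpf` (compose with the collapse `(X, i) ↦ (X, 0)`).
The structure-compatible reading `CompatibleWithPerfectionR` is the one that holds ([FrdI] Thm. 3.4 (iii), proof p.64).
[cite: MochizukiEtTh2009, Cor 3.8 p.81] -/
theorem not_forall_compatibleWithPerfection (h : Cor38Hyp C₁ C₂) :
    ¬ ∀ (P₁ : PerfectionData C₁.opsData) (P₂ : PerfectionData C₂.opsData),
        h.CompatibleWithPerfection P₁ P₂ := by
  classical
  intro H
  -- the junk perfection data `C_i × {0, 1}`, `A ↦ (A, 0)`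
  let ι₁ : C₁.category ⥤ C₁.category × Discrete (Fin 2) :=
    Functor.prod' (𝟭 _) ((Functor.const _).obj (Discrete.mk 0))
  let ι₂ : C₂.category ⥤ C₂.category × Discrete (Fin 2) :=
    Functor.prod' (𝟭 _) ((Functor.const _).obj (Discrete.mk 0))
  let P₁ : PerfectionData C₁.opsData :=
    { Pf := C₁.category × Discrete (Fin 2)
      toPf := ι₁
      root := fun A n => if n = 1 then (A, Discrete.mk 0) else (A, Discrete.mk 1)
      root_one := fun A => if_pos rfl
      root_surjective := fun X => by
        obtain ⟨A, ⟨i⟩⟩ := X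
        fin_cases i
        · exact ⟨A, 1, if_pos rfl⟩
        · exact ⟨A, 2, if_neg (by decide)⟩
      ops := PreFrobenioidData.ofFunctor C₁.divisorMonoid
        (CategoryTheory.Prod.fst C₁.category (Discrete (Fin 2)) ⋙ C₁.toElem) }
  let P₂ : PerfectionData C₂.opsData :=
    { Pf := C₂.category × Discrete (Fin 2)
      toPf := ι₂
      root := fun A n => if n = 1 then (A, Discrete.mk 0) else (A, Discrete.mk 1)
      root_one := fun A => if_pos rfl
      root_surjective := fun X => by
        obtain ⟨A, ⟨i⟩⟩ := X
        fin_cases i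
        · exact ⟨A, 1, if_pos rfl⟩
        · exact ⟨A, 2, if_neg (by decide)⟩
      ops := PreFrobenioidData.ofFunctor C₂.divisorMonoid
        (CategoryTheory.Prod.fst C₂.category (Discrete (Fin 2)) ⋙ C₂.toElem) }
  obtain ⟨B, hBe, ⟨e⟩, huniq⟩ := H P₁ P₂
  -- the collapse `K : (X, i) ↦ (X, 0)`; `B ⋙ K` fits the same square
  let K : C₂.category × Discrete (Fin 2) ⥤ C₂.category × Discrete (Fin 2) :=
    CategoryTheory.Prod.fst C₂.category (Discrete (Fin 2)) ⋙ ι₂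
  have hc' : OneCommutes h.Ψ.functor P₂.toPf P₁.toPf (B ⋙ K) := ⟨Functor.isoWhiskerRight e K⟩
  obtain ⟨f⟩ := huniq (B ⋙ K) hc'
  -- `B` is an equivalence: pick `Y` with `B Y ≅ (X₀, 1)`
  haveI : IsConnected D' := C₂.isConnected
  obtain ⟨X₀⟩ := (inferInstance : Nonempty D')
  haveI : B.IsEquivalence := hBe
  let Z : C₂.category × Discrete (Fin 2) := (⟨X₀, 1⟩, Discrete.mk 1)
  have i : (B ⋙ K).obj (B.objPreimage Z) ≅ Z := f.app (B.objPreimage Z) ≪≫ B.objObjPreimageIso Z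
  -- second components: `0 ⟶ 1` in the discrete category `{0, 1}` — absurd
  have h01 : (0 : Fin 2) = 1 := Discrete.eq_of_hom i.hom.2
  exact absurd h01 (by decide)

/-- **The universal closure of row F-2811 is FALSE** (plan rule R5), given any instance of the Cor. 3.8 data (the
typed structures `RealifiedDivisorMonoids` / `TemperedFrobenioid` / `Cor38Hyp` are inhabited in the tree, e.g. by
abc-iut-w5-d124's `Sec3Cor38CriterionToy` with the identity self-equivalence). [cite: MochizukiEtTh2009, Cor 3.8 p.81] -/
theorem not_forall_forall_compatibleWithPerfection (h : Cor38Hyp C₁ C₂) :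
    ¬ ∀ {C₁' : TemperedFrobenioid T D VD} {C₂' : TemperedFrobenioid T' D' VD'} (h' : Cor38Hyp C₁' C₂')
        (P₁ : PerfectionData C₁'.opsData) (P₂ : PerfectionData C₂'.opsData), h'.CompatibleWithPerfection P₁ P₂ :=
  fun H => h.not_forall_compatibleWithPerfection fun P₁ P₂ => H h P₁ P₂

end Cor38Hyp

end Literature.AnabelianGeometry.EtaleTheta
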